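import Summits.QuantumFields.YangMills.Theorems.UnitScaleTiltFluctuationComparisonRegPrGlobalSlackKernelLegResidualFarV4
import Summits.QuantumFields.YangMills.Theorems.UnitScaleTiltFluctuationComparisonRegPrGlobalSlackKernelLegAnalyticOwnV4
import Summits.QuantumFields.YangMills.Theorems.UnitScaleTiltFluctuationComparisonRegPrGlobalSlackKernelLegDisplay
import HarnessLib

/-!
# `UnitScaleTiltFluctuationComparisonRegPrGlobalSlackKernelLegDisplayV4` — THE v4 TWIN (★★OWNER RULING g26-№14 (F-2b); P22b display branch, width seat ym-ust-20520-w2 g4; skeleton v5kD; record-free decls imported from `…GlobalSlackKernelLegDisplay`) of `…GlobalSlackKernelLegDisplay` — 3⁗χ AS ONE PER-RUN DISPLAY OBLIGATION: THE SEVEN ROWS A v4 (α) RECORD MUST SHOW, AND NOTHING ELSE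
# (crux `FluctuationComparisonRegPrIntL`, stmt-QuantumFields-20520, skeleton v5kC, STUB 3⁗χ `stub_globalTwoRunSlackFamChiV4`; width seat ym-ust-20520-w1 g0, count-neutral helper — CAPSTONE of the seat)

WHY.  This seat's files re-typed the analytic leg rows of 3⁗χ (★r1 g4's `K1aLegRowsRChiV4`) so that every row is a `∀ K`-statement about ONE run's package (`…Ref`, `…RefOwn`, `…PerRun`,
`…Weighted`, `…AnalyticOwn`), proved what the displayed core record gives (`…Birth`: the canonical birth chart family, birth-level `TaylorSplitΦ`, Cauchy kernel bounds; ★w3: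
the step-chart far terms in `θ⁷` currency), and split the residual row into print-shaped pieces (`…ResidualSplit`, `…ResidualFar`).  This file assembles the result as ONE predicate:

* §1 **`K1aLegRowsDisplayChiV4 L 𝔠 a₀ a₁ a`** — rates/constants/threshold; per family / coupling the reference objects `Ψ` (height-free charts) and `BR` (coherent loop-variable functional)
  BEFORE the (α) hypothesis; per inhabited χ-package a coherent `p` and `(Φ, e, B)` with SEVEN ROWS, each about one run:
  (R1) `KernelRefOwnΦ` — the charts' weighted flat kernels near `Ψ`'s, rate `(L^{−(1+b)})^a` ([King1986] Prop. 3.6);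
  (R2′) `ChartAnalyticΦ … (rescaleΦw (canonLegDist F) κ′ Φ) 𝔠.κ ρ C_A` — LEG-WEIGHTED ANALYTICITY ([Balaban1985UV3] (25), (29)–(30), p.264's propagator chains; own-indexed form +
       transfer in `…AnalyticOwn`);
  (N) `NewLevelIsBirthRows` — on the new level `(Φ, e, B)` IS `(birthChartRows, 0, Bcfg)` (definitional);
  (M1) `OldTermsAreJetsOwnRows` — old terms are the jets of `Φ` at `B` plus `e` ((43) p.266, EXACT);
  (F^Λ) `LambdaFarSmallOwnRows` — the (61)-born far terms in `θ⁷` currency (G3D-07 with its spare coupling; the step-chart far terms are a THEOREM, ★w3 p585502);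
  (R4) `CfgDistOwnΦ` — (44) in distance form; (R5) `CfgRefOwnΦ` — loop variables near `BR` ([King1986] Prop. 3.9 / the variational side).
* §2 **`k1aLegRowsOwnAChiV4_of_displayV4`** (`remainderSmallOwnΦ_chiV4_of_jets_lambdaRows` supplies (R3)) and the capstone **`globalTwoRunSlackFamChiV4_of_k1aLegRowsDisplayChiV4 : … → ⟨3⁗χ TEXT VERBATIM⟩`**.
WHAT THIS SAYS TO THE OWNER / NODE O.  Closing 3⁗χ over the per-`K` `Classical.choice` witnesses of 2′χ = making each of (R1), (R2′), (M1), (F^Λ), (R4), (R5) a FIELD (or consequence) of run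
`K`'s v4 record, with `Ψ := ψRef F 𝔠 γ`, `BR := bRef F 𝔠 γ` fixed tree definitions and `Φ` the (all-level, y-anchored) canonical chart family extending `birthChartRows`.  No recipe for a
coherent family, no two-run row inside the record.  HONEST FRAMING: a typed obligation list with kernel-checked reductions; NOTHING of [Balaban1985UV3]/[King1986] is asserted or proved
here; the stub, the crux and the (α) record are untouched; YM₃ on T³ is a rung, not the Clay problem / 𝕋⁴ / a mass gap.

References: T. Bałaban, CMP 102 (1985) 255–275 [Balaban1985UV3] ((25) p.262, (27)–(30) p.263, (33)–(34) p.264, (43)–(45) pp.266–267, (57) p.270, (61)–(63) pp.271–272); C. King,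
CMP 102 (1986) 649–677 [King1986] (Thm 3.4 (3.9) p.656, Prop. 3.6 (3.56) p.662, (3.58)–(3.61) p.663, Prop. 3.9 (3.71)–(3.74) pp.664–665).
-/

set_option autoImplicit false

noncomputable section

open scoped BigOperators
open Finset
open Literature.MathematicalPhysics.QuantumFieldTheory.Balaban1983to89
open Literature.MathematicalPhysics.QuantumFieldTheory.Balaban1983to89.T3ContinuumYM3Torus
open Literature.MathematicalPhysics.QuantumFieldTheory.Balaban1983to89.T3UnitScaleTilt
open Literature.MathematicalPhysics.QuantumFieldTheory.Balaban1983to89.T3LevelShift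
open Literature.MathematicalPhysics.QuantumFieldTheory.Balaban1983to89.T3AlphaInputsAC
open Literature.MathematicalPhysics.QuantumFieldTheory.Balaban1983to89.T3AlphaPolymerSocket
open Literature.MathematicalPhysics.QuantumFieldTheory.Balaban1983to89.T3AlphaInputsACTwoRun
open Literature.MathematicalPhysics.QuantumFieldTheory.Balaban1983to89.T3AlphaInputsACTwoRunLevel
open Literature.MathematicalPhysics.QuantumFieldTheory.Balaban1985CMP102
open Literature.MathematicalPhysics.QuantumFieldTheory.Balaban1985CMP102.Setting
open Summit.QuantumFields.Balaban3D.Carriers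
open Summit.QuantumFields.Balaban3D.Proofs.Primitives
open Summit.QuantumFields.Balaban3D.Proofs.GroupModelLieC (lieC)
open Summit.QuantumFields.Balaban3D.Proofs.NewbornJet (tlConst tlConst_nonneg)
open Summit.QuantumFields.YangMills.Theorems
open Summit.QuantumFields.YangMills.Theorems.GlobalSlackKernelMatching
open Summit.QuantumFields.YangMills.Theorems.GlobalSlackCanonicalPolymers

namespace Summit.QuantumFields.YangMills.Theorems.GlobalSlackKernelLeg

/-! ## §1 The display obligation -/

/-- **3⁗χ AS ONE PER-RUN DISPLAY OBLIGATION** (hypothesis schema, never asserted): a weight rate `κ′ > 0`, a radius `ρ > 0`, nonnegative constants, a threshold `γB`; for every family /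
coupling a height-free reference chart family `Ψ` and a coherent reference configuration functional `BR` (BEFORE the (α) hypothesis); for every inhabited χ-package a coherent
`p : ∀ K, PkgAtV3Chi …` and ONE `(Φ, e, B)` with the seven rows (R1) `KernelRefOwnΦ`, (R2′) leg-weighted analyticity `ChartAnalyticΦ … (rescaleΦw (canonLegDist F) κ′ Φ)`, (N) `NewLevelIsBirthRows`,
(M1) `OldTermsAreJetsOwnRows`, (F^Λ) `LambdaFarSmallOwnRows`, (R4) `CfgDistOwnΦ`, (R5) `CfgRefOwnΦ` — each a statement about one run's package on its own lattices.
[cite: King1986, Thm 3.4 (3.9) p.656, Prop. 3.6 (3.56) p.662, Prop. 3.9 (3.71)-(3.74) p.665; Balaban1985UV3, (25) p.262, (43)-(45) pp.266-267, (57) p.270, (61)-(63) pp.271-272] -/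
def K1aLegRowsDisplayChiV4 (L : ℕ) (𝔠 : AlphaConsts L (suGroupModel 2).N) (a₀ a₁ a : ℝ) : Prop :=
  ∃ (κ' ρ C C_A C_Λ C_s C_B γB : ℝ), 0 < κ' ∧ 0 < ρ ∧ 0 ≤ C ∧ 0 ≤ C_A ∧ 0 ≤ C_Λ ∧ 0 ≤ C_s ∧ 0 ≤ C_B ∧ 0 < γB ∧
    ∀ (F : T3Family) (γ : ℝ) (hF : F.L = L) (hγ : 0 < γ), γ ≤ γB → ∀ (hγ1 : γ ≤ (min (hF ▸ 𝔠).gamma0 1) ^ 2),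
      ∃ (Ψ : ChartFam ↥(lieC (suGroupModel 2)) F) (BR : CfgFam ↥(lieC (suGroupModel 2)) F), KerHeightFree Ψ ∧ RefCfgCoherent BR ∧
        (AlphaInputsT3AC.OfV4ChiAt F (hF ▸ 𝔠) a₀ a₁ →
          ∃ (p : ∀ K, AlphaInputsT3AC.PkgAtV4Chi F (hF ▸ 𝔠) γ hγ hγ1 K), (∀ K, (p K).a₀ = a₀ ∧ (p K).a₁ = a₁) ∧
            ∃ (Φ : ChartFam ↥(lieC (suGroupModel 2)) F) (e : VacFam F) (B : CfgFam ↥(lieC (suGroupModel 2)) F),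
              KernelRefOwnΦ (AlphaInputsT3AC.dataOfV4chi p (canonPolymerRows fun K => (p K).toRows)) Φ Ψ (canonLegDist F) κ' (hF ▸ 𝔠).κ a C ∧
              ChartAnalyticΦ (AlphaInputsT3AC.dataOfV4chi p (canonPolymerRows fun K => (p K).toRows)) (rescaleΦw (canonLegDist F) κ' Φ) (hF ▸ 𝔠).κ ρ C_A ∧
              NewLevelIsBirthRows (fun K => (p K).toRows) Φ e B ∧
              OldTermsAreJetsOwnRows (fun K => (p K).toRows) Φ e B ∧
              LambdaFarSmallOwnRows (fun K => (p K).toRows) (hF ▸ 𝔠).b₀ (hF ▸ 𝔠).p₀ (hF ▸ 𝔠).κ C_Λ ∧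
              CfgDistOwnΦ (AlphaInputsT3AC.dataOfV4chi p (canonPolymerRows fun K => (p K).toRows)) B (canonLegDist F) (hF ▸ 𝔠).b₀ (hF ▸ 𝔠).p₀ C_s ∧
              CfgRefOwnΦ (AlphaInputsT3AC.dataOfV4chi p (canonPolymerRows fun K => (p K).toRows)) B BR (canonLegDist F) (hF ▸ 𝔠).b₀ (hF ▸ 𝔠).p₀ a C_B)

/-! ## §2 The reductions and the registered text -/

-- (record-free `stepFarConstL`: imported from the v3 module, not restated)

-- (record-free `stepFarConst_eq`: imported from the v3 module, not restated)

-- (record-free `stepFarConstL_nonneg`: imported from the v3 module, not restated)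

/-- **THE DISPLAY OBLIGATION GIVES THE DISPLAY-LEVEL SOCKET**: `K1aLegRowsDisplayChiV4 → K1aLegRowsOwnAChiV4` — (R3) with constant `stepFarConstL L 𝔠 + C_Λ` from (N) ∧ (M1) ∧ (F^Λ)
(`remainderSmallOwnΦ_chiV4_of_jets_lambdaRows`; ★w3's `abs_stepFarRows_le_theta7` inside), the other rows verbatim. [cite: Balaban1985UV3, (43) p.266, (57) p.270] -/
theorem k1aLegRowsOwnAChiV4_of_displayV4 {L : ℕ} {𝔠 : AlphaConsts L (suGroupModel 2).N} {a₀ a₁ a : ℝ} (h : K1aLegRowsDisplayChiV4 L 𝔠 a₀ a₁ a) :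
    K1aLegRowsOwnAChiV4 L 𝔠 a₀ a₁ a := by
  obtain ⟨κ', ρ, C, C_A, C_Λ, C_s, C_B, γB, hκ', hρ, hC, hCA, hCΛ, hCs, hCB, hγB, hall⟩ := h
  refine ⟨κ', ρ, C, C_A, stepFarConstL L 𝔠 + C_Λ, C_s, C_B, γB, hκ', hρ, hC, hCA, add_nonneg (stepFarConstL_nonneg L 𝔠) hCΛ, hCs, hCB, hγB,
    fun F γ hF hγ hγle hγ1 => ?_⟩
  obtain ⟨Ψ, BR, hΨ, hBR, himp⟩ := hall F γ hF hγ hγle hγ1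
  refine ⟨Ψ, BR, hΨ, hBR, fun hOf => ?_⟩
  obtain ⟨p, hp, Φ, e, B, hK, hA, hN, hM1, hΛ, hS, hBC⟩ := himp hOf
  subst hF
  exact ⟨p, hp, Φ, e, B, hK, hA, remainderSmallOwnΦ_chiV4_of_jets_lambdaRows p hCΛ hN hM1 hΛ, hS, hBC⟩

/-- **THE REGISTERED STUB 3⁗χ FROM THE PER-RUN DISPLAY OBLIGATION, BY NAME** (`globalTwoRunSlackFamChiV4_of_k1aLegRowsOwnAChiV4 ∘ k1aLegRowsOwnAChiV4_of_displayV4`): if for every odd `L ≥ 7`,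
every constants record and [7]-constants there is a rate exponent `0 < a < 1` with `K1aLegRowsDisplayChiV4 L 𝔠 a₀ a₁ a`, then the text of `stub_globalTwoRunSlackFamChiV4` (skeleton v5kC
of stmt-QuantumFields-20520) holds VERBATIM. [cite: King1986, Thm 3.4 (3.9) p.656, Prop. 3.6 (3.56) p.662; Balaban1985UV3, (43)-(47) pp.266-267, (57) p.270] -/
theorem globalTwoRunSlackFamChiV4_of_k1aLegRowsDisplayChiV4
    (h : ∀ (L : ℕ), Odd L → 7 ≤ L → ∀ (𝔠 : AlphaConsts L (suGroupModel 2).N) (a₀ a₁ : ℝ), 0 < a₀ → 0 < a₁ → 𝔠.B₃ * a₁ ≤ a₀ →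
      ∃ a : ℝ, 0 < a ∧ a < 1 ∧ K1aLegRowsDisplayChiV4 L 𝔠 a₀ a₁ a) :
    ∀ (L : ℕ), Odd L → 7 ≤ L → ∀ (𝔠 : Summit.QuantumFields.Balaban3D.Proofs.Primitives.AlphaConsts L (Summit.QuantumFields.Balaban3D.Carriers.suGroupModel 2).N)
      (a₀ a₁ : ℝ), 0 < a₀ → 0 < a₁ → 𝔠.B₃ * a₁ ≤ a₀ →
      ∃ a : ℝ, 0 < a ∧ ∃ γB : ℝ, 0 < γB ∧ ∀ (F : T3Family) (γ : ℝ) (hF : F.L = L) (hγ : 0 < γ), γ ≤ γB →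
        ∀ (hγ1 : γ ≤ (min (hF ▸ 𝔠).gamma0 1) ^ 2),
          Summit.QuantumFields.YangMills.Theorems.AlphaInputsT3AC.OfV4ChiAt F (hF ▸ 𝔠) a₀ a₁ →
          ∃ (p : ∀ K, Summit.QuantumFields.YangMills.Theorems.AlphaInputsT3AC.PkgAtV4Chi F (hF ▸ 𝔠) γ hγ hγ1 K),
            (∀ K, (p K).a₀ = a₀ ∧ (p K).a₁ = a₁) ∧
            ∃ (π : Summit.QuantumFields.YangMills.Theorems.AlphaInputsT3AC.PolymerT3 F) (σ : ℕ) (C : ℝ), 7 ≤ σ ∧ 0 ≤ C ∧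
              Summit.QuantumFields.YangMills.Theorems.GlobalSlack.GlobalSupRateTSlack (Summit.QuantumFields.YangMills.Theorems.AlphaInputsT3AC.dataOfV4chi p π) (hF ▸ 𝔠).b₀ (hF ▸ 𝔠).p₀ a σ C :=
  globalTwoRunSlackFamChiV4_of_k1aLegRowsOwnAChiV4 fun L hLo h7 𝔠 a₀ a₁ ha0 ha1 hw => by
    obtain ⟨a, ha, ha1', hc⟩ := h L hLo h7 𝔠 a₀ a₁ ha0 ha1 hw
    exact ⟨a, ha, ha1', k1aLegRowsOwnAChiV4_of_displayV4 hc⟩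

end Summit.QuantumFields.YangMills.Theorems.GlobalSlackKernelLeg

end
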